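import Mathlib
import Summits.FinalStateConjecture.FinalStateConjecture.Theorems.EternalPapapetrouSchwarzschildExteriorModeRigidityJets
import Summits.FinalStateConjecture.FinalStateConjecture.Theorems.EternalPapapetrouSchwarzschildExteriorModeRigiditySphereMean
import Summits.FinalStateConjecture.FinalStateConjecture.Theorems.EternalPapapetrouSchwarzschildExteriorModeRigiditySpherePDE
import Summits.FinalStateConjecture.FinalStateConjecture.Theorems.EternalPapapetrouSchwarzschildExteriorModeRigidityCoord
import HarnessLib

/-!
# Route EternalPapapetrou · SchwarzschildExteriorModeRigidity — the reduced system for the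
# spherical projections

Helper file for item stmt-FinalStateConjecture-10039 (`SchwarzschildExteriorModeRigidity`).

For `Φ` of class `C²` on the exterior `{‖x⃗‖ > 2M}` solving the Schwarzschild wave equation in
Kerr–Schild coordinates (frame form), the projections `u = ∫ G(θ) Φ(t, rθ) dσ(θ)` on the
eigenfunctions `G` of the spherical Laplacian (`T G = −λ G`) solve the reduced `1+1` system
`−(1+2M/r)u_tt + (4M/r)u_tr + (2M/r²)u_t + (1−2M/r)u_rr + (2/r)(1−M/r)u_r − λr⁻²u = 0`
(`sphereMean_pde`). [folklore]
-/

set_option linter.dupNamespace false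

noncomputable section

namespace Summit.FinalStateConjecture.FinalStateConjecture.Theorems

open MeasureTheory Set Filter Topology Metric Literature.Geometry.Lorentzian
  Literature.Analysis.Calculus Literature.Analysis.FluidPDE

namespace EternalPapapetrou.ModeRigidity

/-! ### Scalar algebra of the reduction -/

/-- The linear algebra behind the reduced equation. [folklore] -/
theorem reduced_algebra {M r BTT BTι BιT Bιι LT Lι S S3 : ℝ} (hr : r ≠ 0) (hsym : BTι = BιT)
    (htr : S3 = Bιι + 2 / r * Lι + (r ^ 2)⁻¹ * S)
    (hframe : -(1 + 2 * M / r) * BTT + 2 * M / r ^ 2 * (r * BTι + r * BιT) -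
      2 * M / r ^ 3 * (r * (r * Bιι)) + S3 + 2 * M / r ^ 2 * LT - 2 * M / r ^ 3 * (r * Lι) = 0) :
    -(1 + 2 * M / r) * BTT + 4 * M / r * BιT + 2 * M / r ^ 2 * LT + (1 - 2 * M / r) * Bιι +
      2 / r * (1 - M / r) * Lι + (r ^ 2)⁻¹ * S = 0 := by
  subst htr hsym
  field_simp at hframe
  field_simp
  linear_combination hframe

/-! ### The setting -/

/-- The exterior `{‖x⃗‖ > 2M}` as a subset of `E4` is open. [folklore] -/
theorem isOpen_exteriorSet (M : ℝ) : IsOpen {x : E4 | 2 * M < ‖E4.spatial x‖} :=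
  isOpen_lt continuous_const (continuous_norm.comp E4.spatial.continuous)

/-- The spheres over the strip lie in the exterior. [folklore] -/
theorem spt_mem_exteriorSet {M : ℝ} {q : ℝ × ℝ} (hq : q ∈ strip M) (θ : S2) :
    spt q θ ∈ {x : E4 | 2 * M < ‖E4.spatial x‖} := by
  show 2 * M < ‖E4.spatial (spt q θ)‖
  rw [spatial_spt, norm_smul, norm_eq_of_mem_sphere θ, mul_one, Real.norm_eq_abs]
  exact lt_of_lt_of_le hq.2 (le_abs_self _)

/-- `‖x⃗‖ = r` on the sphere of radius `r > 0`. [folklore] -/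
theorem norm_spatial_spt {q : ℝ × ℝ} (hq : 0 < q.2) (θ : S2) : ‖E4.spatial (spt q θ)‖ = q.2 := by
  rw [spatial_spt, norm_smul, norm_eq_of_mem_sphere θ, mul_one, Real.norm_eq_abs, abs_of_pos hq]

/-- `sembed θ ∂ₜ = ∂₀`. [folklore] -/
@[simp]
theorem sembed_e₁ (θ : E3) : sembed θ e₁ = E4.basisVector 0 := by
  rw [sembed_apply]; simp [spt]

/-- `sembed θ ∂ᵣ = (0, θ)`. [folklore] -/
@[simp]
theorem sembed_e₂ (θ : E3) : sembed θ e₂ = E4.spaceEmbed θ := by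
  rw [sembed_apply]; simp [spt]

/-- On the unit sphere, `‖(0, θ)‖ = 1`. [folklore] -/
theorem norm_spaceEmbed_sphere (θ : S2) : ‖E4.spaceEmbed (θ : E3)‖ = 1 := by
  have h : ‖E4.spaceEmbed (θ : E3)‖ = ‖(θ : E3)‖ := by
    rw [EuclideanSpace.norm_eq, EuclideanSpace.norm_eq, Fin.sum_univ_succ]
    simp [E4.ofTimeSpace_apply_zero, E4.ofTimeSpace_apply_succ]
  rw [h, norm_eq_of_mem_sphere θ]

section Reduction

variable {M : ℝ} (hM : 0 < M) {Φ : E4 → ℝ} (hΦ : ContDiffOn ℝ 2 Φ {x : E4 | 2 * M < ‖E4.spatial x‖})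
  (hW : ∀ x : E4, 2 * M < ‖E4.spatial x‖ →
    ∑ μ, ∑ ν, Kerr.inverseMetric M 0 x μ ν *
        fderiv ℝ (fderiv ℝ Φ) x (E4.basisVector μ) (E4.basisVector ν) +
      ∑ ν, Kerr.divInverseMetric M 0 x ν * fderiv ℝ Φ x (E4.basisVector ν) = 0)

include hM hΦ hW in
/-- **The pointwise reduced identity** on the sphere `{t} × S_r`: the wave equation at
`x = (t, rθ)` in the form `−(1+2M/r)Φ_TT + (4M/r)Φ_ιT + (2M/r²)Φ_T + (1−2M/r)Φ_ιι +
(2/r)(1−M/r)Φ_ι + r⁻² T(Φ(t,·))(rθ) = 0`. [folklore] -/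
theorem pointwise_reduced {p : ℝ × ℝ} (hp : p ∈ strip M) (θ : S2) :
    -(1 + 2 * M / p.2) * fderiv ℝ (fderiv ℝ Φ) (spt p θ) (E4.basisVector 0) (E4.basisVector 0) +
      4 * M / p.2 * fderiv ℝ (fderiv ℝ Φ) (spt p θ) (E4.spaceEmbed θ) (E4.basisVector 0) +
      2 * M / p.2 ^ 2 * fderiv ℝ Φ (spt p θ) (E4.basisVector 0) +
      (1 - 2 * M / p.2) * fderiv ℝ (fderiv ℝ Φ) (spt p θ) (E4.spaceEmbed θ) (E4.spaceEmbed θ) +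
      2 / p.2 * (1 - M / p.2) * fderiv ℝ Φ (spt p θ) (E4.spaceEmbed θ) +
      (p.2 ^ 2)⁻¹ * sphLaplacian (EuclideanSpace.basisFun (Fin 3) ℝ)
        (fun y : E3 ↦ Φ (E4.ofTimeSpace p.1 y)) (p.2 • (θ : E3)) = 0 := by
  have h2M : 0 < 2 * M := by linarith
  have hr : 0 < p.2 := lt_trans h2M hp.2
  have hO := isOpen_exteriorSet M
  have hxO := spt_mem_exteriorSet hp θ
  have hnorm := norm_spatial_spt hr θ
  have hx0 : E4.spatial (spt p θ) ≠ 0 := by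
    rw [← norm_ne_zero_iff, hnorm]; exact hr.ne'
  have hframe := (schwarzschild_frame_form M hx0 (fderiv ℝ (fderiv ℝ Φ) (spt p θ))
    (fderiv ℝ Φ (spt p θ))).symm.trans (hW _ hxO)
  rw [hnorm, spatial_spt] at hframe
  simp only [map_smul, FunLike.coe_smul, Pi.smul_apply, smul_eq_mul] at hframe
  have hsym : fderiv ℝ (fderiv ℝ Φ) (spt p θ) (E4.basisVector 0) (E4.spaceEmbed θ) =
      fderiv ℝ (fderiv ℝ Φ) (spt p θ) (E4.spaceEmbed θ) (E4.basisVector 0) :=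
    (hΦ.contDiffAt (hO.mem_nhds hxO)).isSymmSndFDerivAt (by simp) _ _
  have hy : E4.ofTimeSpace p.1 (p.2 • (θ : E3)) ∈ {x : E4 | 2 * M < ‖E4.spatial x‖} := by
    rw [← spt_eq]; exact hxO
  have htr := spatial_trace_eq hO hΦ hr.ne' (norm_eq_of_mem_sphere θ) hy
  rw [← spt_eq] at htr
  exact reduced_algebra hr.ne' hsym htr hframe

/-- Time slices of `Φ` are `C²` on the spatial shell `{‖y‖ > 2M}`. [folklore] -/
theorem contDiffOn_slice (hΦ : ContDiffOn ℝ 2 Φ {x : E4 | 2 * M < ‖E4.spatial x‖}) (t : ℝ) :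
    ContDiffOn ℝ 2 (fun y : E3 ↦ Φ (E4.ofTimeSpace t y)) {y : E3 | 2 * M < ‖y‖} := by
  have hA : ContDiff ℝ 2 (fun y : E3 ↦ E4.ofTimeSpace t y) := by
    have : (fun y : E3 ↦ E4.ofTimeSpace t y) = fun y ↦ t • E4.basisVector 0 + E4.spaceEmbed y :=
      funext fun y ↦ E4.ofTimeSpace_eq_smul_add' t y
    rw [this]
    exact contDiff_const.add E4.spaceEmbed.contDiff
  refine hΦ.comp hA.contDiffOn fun y hy ↦ ?_
  show 2 * M < ‖E4.spatial (E4.ofTimeSpace t y)‖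
  rw [E4.spatial_ofTimeSpace]
  exact hy

variable {K : ℕ} (a : Fin (MvPoly.HomL2.dim 3 K))

omit hM in
/-- Continuity of the eigenfunction weight. [folklore] -/
theorem continuous_Gf : Continuous (MvPoly.HomL2.eigenfun (K := K) two_le_three a) :=
  (MvPoly.HomL2.contDiff_eigenfun (m := 0) two_le_three a).continuous

include hM hΦ hW in
/-- **The reduced equation for the projections** `u = ∫ G(θ) Φ(t, rθ) dσ(θ)` on an eigenfunction
`G` (`T G = −λ G`) of the spherical Laplacian:
`−(1+2M/r)u_tt + (4M/r)u_tr + (2M/r²)u_t + (1−2M/r)u_rr + (2/r)(1−M/r)u_r − λ r⁻² u = 0`.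
[folklore] -/
theorem sphereMean_pde {p : ℝ × ℝ} (hp : p ∈ strip M) :
    -(1 + 2 * M / p.2) * fderiv ℝ (fun q ↦ fderiv ℝ (sphereMean (MvPoly.HomL2.eigenfun (K := K) two_le_three a) Φ) q e₁) p e₁ +
      4 * M / p.2 * fderiv ℝ (fun q ↦ fderiv ℝ (sphereMean (MvPoly.HomL2.eigenfun (K := K) two_le_three a) Φ) q e₁) p e₂ +
      2 * M / p.2 ^ 2 * fderiv ℝ (sphereMean (MvPoly.HomL2.eigenfun (K := K) two_le_three a) Φ) p e₁ +
      (1 - 2 * M / p.2) * fderiv ℝ (fun q ↦ fderiv ℝ (sphereMean (MvPoly.HomL2.eigenfun (K := K) two_le_three a) Φ) q e₂) p e₂ +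
      2 / p.2 * (1 - M / p.2) * fderiv ℝ (sphereMean (MvPoly.HomL2.eigenfun (K := K) two_le_three a) Φ) p e₂ +
      (p.2 ^ 2)⁻¹ * (-(MvPoly.HomL2.eigenlam (K := K) two_le_three a) * sphereMean (MvPoly.HomL2.eigenfun (K := K) two_le_three a) Φ p) = 0 := by
  have h2M : 0 < 2 * M := by linarith
  have hr : 0 < p.2 := lt_trans h2M hp.2
  have hO := isOpen_exteriorSet M
  have hΩ : IsOpen (strip M) := isOpen_strip M
  have hmaps : ∀ q ∈ strip M, ∀ θ : S2, spt q θ ∈ {x : E4 | 2 * M < ‖E4.spatial x‖} :=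
    fun q hq θ ↦ spt_mem_exteriorSet hq θ
  have hG : Continuous (MvPoly.HomL2.eigenfun (K := K) two_le_three a) := continuous_Gf a
  set lam := MvPoly.HomL2.eigenlam (K := K) two_le_three a with hlam
  -- the derivatives under the integral sign
  rw [fderiv_sphereMean_apply hO hΦ hG hΩ hmaps hp, fderiv_sphereMean_apply hO hΦ hG hΩ hmaps hp,
    fderiv_fderiv_sphereMean_apply hO hΦ hG hΩ hmaps hp,
    fderiv_fderiv_sphereMean_apply hO hΦ hG hΩ hmaps hp,
    fderiv_fderiv_sphereMean_apply hO hΦ hG hΩ hmaps hp]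
  simp only [sembed_e₁, sembed_e₂]
  unfold sphereMean
  -- continuity of the pieces in `θ`
  have hθx : Continuous fun θ : S2 ↦ spt p θ :=
    continuous_spt.comp (continuous_const.prodMk continuous_subtype_val)
  have hGθ : Continuous fun θ : S2 ↦ (MvPoly.HomL2.eigenfun (K := K) two_le_three a) θ := hG.comp continuous_subtype_val
  have hι : Continuous fun θ : S2 ↦ E4.spaceEmbed (θ : E3) :=
    E4.spaceEmbed.continuous.comp continuous_subtype_val
  have hΦθ : Continuous fun θ : S2 ↦ Φ (spt p θ) :=
    hΦ.continuousOn.comp_continuous hθx fun θ ↦ hmaps p hp θ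
  have hLθ : Continuous fun θ : S2 ↦ fderiv ℝ Φ (spt p θ) :=
    (hΦ.continuousOn_fderiv_of_isOpen hO (by norm_num)).comp_continuous hθx fun θ ↦ hmaps p hp θ
  have hBθ : Continuous fun θ : S2 ↦ fderiv ℝ (fderiv ℝ Φ) (spt p θ) :=
    ((hΦ.fderiv_of_isOpen hO le_rfl).continuousOn_fderiv_of_isOpen hO le_rfl).comp_continuous hθx
      fun θ ↦ hmaps p hp θ
  have cpt : ∀ {f : S2 → ℝ}, Continuous f → Integrable f (volume : Measure E3).toSphere :=
    fun hf ↦ hf.integrable_of_hasCompactSupport (HasCompactSupport.of_compactSpace _)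
  have i0 : Integrable (fun θ : S2 ↦ (MvPoly.HomL2.eigenfun (K := K) two_le_three a) θ * Φ (spt p θ)) (volume : Measure E3).toSphere :=
    cpt (hGθ.mul hΦθ)
  have iT : Integrable (fun θ : S2 ↦ (MvPoly.HomL2.eigenfun (K := K) two_le_three a) θ * fderiv ℝ Φ (spt p θ) (E4.basisVector 0))
      (volume : Measure E3).toSphere := cpt (hGθ.mul (hLθ.clm_apply continuous_const))
  have iι : Integrable (fun θ : S2 ↦ (MvPoly.HomL2.eigenfun (K := K) two_le_three a) θ * fderiv ℝ Φ (spt p θ) (E4.spaceEmbed (θ : E3)))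
      (volume : Measure E3).toSphere := cpt (hGθ.mul (hLθ.clm_apply hι))
  have iTT : Integrable (fun θ : S2 ↦ (MvPoly.HomL2.eigenfun (K := K) two_le_three a) θ *
      fderiv ℝ (fderiv ℝ Φ) (spt p θ) (E4.basisVector 0) (E4.basisVector 0))
      (volume : Measure E3).toSphere :=
    cpt (hGθ.mul ((hBθ.clm_apply continuous_const).clm_apply continuous_const))
  have iιT : Integrable (fun θ : S2 ↦ (MvPoly.HomL2.eigenfun (K := K) two_le_three a) θ *
      fderiv ℝ (fderiv ℝ Φ) (spt p θ) (E4.spaceEmbed (θ : E3)) (E4.basisVector 0))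
      (volume : Measure E3).toSphere :=
    cpt (hGθ.mul ((hBθ.clm_apply hι).clm_apply continuous_const))
  have iιι : Integrable (fun θ : S2 ↦ (MvPoly.HomL2.eigenfun (K := K) two_le_three a) θ *
      fderiv ℝ (fderiv ℝ Φ) (spt p θ) (E4.spaceEmbed (θ : E3)) (E4.spaceEmbed (θ : E3)))
      (volume : Measure E3).toSphere :=
    cpt (hGθ.mul ((hBθ.clm_apply hι).clm_apply hι))
  -- collect everything under one integral
  rw [← integral_const_mul, ← integral_const_mul, ← integral_const_mul, ← integral_const_mul,
    ← integral_const_mul, ← integral_const_mul, ← integral_const_mul,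
    ← integral_add ((iTT.const_mul _)) (iιT.const_mul _)]
  rw [← integral_add ?_ (iT.const_mul _)]
  swap; · exact (iTT.const_mul _).add (iιT.const_mul _)
  rw [← integral_add ?_ (iιι.const_mul _)]
  swap; · exact ((iTT.const_mul _).add (iιT.const_mul _)).add (iT.const_mul _)
  rw [← integral_add ?_ (iι.const_mul _)]
  swap; · exact (((iTT.const_mul _).add (iιT.const_mul _)).add (iT.const_mul _)).add (iιι.const_mul _)
  rw [← integral_add ?_ ((i0.const_mul _).const_mul _)]
  swap
  · exact ((((iTT.const_mul _).add (iιT.const_mul _)).add (iT.const_mul _)).add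
      (iιι.const_mul _)).add (iι.const_mul _)
  -- the pointwise identity
  set S : S2 → ℝ := fun θ ↦ sphLaplacian (EuclideanSpace.basisFun (Fin 3) ℝ)
    (fun y : E3 ↦ Φ (E4.ofTimeSpace p.1 y)) (p.2 • (θ : E3)) with hS
  have hIeq : ∀ θ : S2,
      -(1 + 2 * M / p.2) * ((MvPoly.HomL2.eigenfun (K := K) two_le_three a) θ *
          fderiv ℝ (fderiv ℝ Φ) (spt p θ) (E4.basisVector 0) (E4.basisVector 0)) +
        4 * M / p.2 * ((MvPoly.HomL2.eigenfun (K := K) two_le_three a) θ *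
          fderiv ℝ (fderiv ℝ Φ) (spt p θ) (E4.spaceEmbed (θ : E3)) (E4.basisVector 0)) +
        2 * M / p.2 ^ 2 * ((MvPoly.HomL2.eigenfun (K := K) two_le_three a) θ * fderiv ℝ Φ (spt p θ) (E4.basisVector 0)) +
        (1 - 2 * M / p.2) * ((MvPoly.HomL2.eigenfun (K := K) two_le_three a) θ *
          fderiv ℝ (fderiv ℝ Φ) (spt p θ) (E4.spaceEmbed (θ : E3)) (E4.spaceEmbed (θ : E3))) +
        2 / p.2 * (1 - M / p.2) * ((MvPoly.HomL2.eigenfun (K := K) two_le_three a) θ * fderiv ℝ Φ (spt p θ) (E4.spaceEmbed (θ : E3))) +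
        (p.2 ^ 2)⁻¹ * (-lam * ((MvPoly.HomL2.eigenfun (K := K) two_le_three a) θ * Φ (spt p θ))) =
      -(p.2 ^ 2)⁻¹ * ((MvPoly.HomL2.eigenfun (K := K) two_le_three a) θ * S θ + lam * ((MvPoly.HomL2.eigenfun (K := K) two_le_three a) θ * Φ (spt p θ))) := by
    intro θ
    have h := pointwise_reduced hM hΦ hW hp θ
    simp only [hS]
    linear_combination ((MvPoly.HomL2.eigenfun (K := K) two_le_three a) θ) * h
  rw [integral_congr_ae (Eventually.of_forall hIeq), integral_const_mul]
  -- the sphere integration by parts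
  have hq := contDiffOn_slice hΦ p.1
  have hibp := integral_eigenfun_mul_sphLaplacian h2M.le hp.2 hq a
  have hsame : ∫ θ : S2, (MvPoly.HomL2.eigenfun (K := K) two_le_three a) θ * Φ (E4.ofTimeSpace p.1 (p.2 • (θ : E3)))
      ∂(volume : Measure E3).toSphere = ∫ θ : S2, (MvPoly.HomL2.eigenfun (K := K) two_le_three a) θ * Φ (spt p θ)
      ∂(volume : Measure E3).toSphere := by
    simp_rw [spt_eq]
  have hGS : Integrable (fun θ : S2 ↦ (MvPoly.HomL2.eigenfun (K := K) two_le_three a) θ * S θ) (volume : Measure E3).toSphere := by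
    -- `G S` is a combination of integrable functions
    have hI : Integrable (fun θ : S2 ↦
      -(1 + 2 * M / p.2) * ((MvPoly.HomL2.eigenfun (K := K) two_le_three a) θ *
          fderiv ℝ (fderiv ℝ Φ) (spt p θ) (E4.basisVector 0) (E4.basisVector 0)) +
        4 * M / p.2 * ((MvPoly.HomL2.eigenfun (K := K) two_le_three a) θ *
          fderiv ℝ (fderiv ℝ Φ) (spt p θ) (E4.spaceEmbed (θ : E3)) (E4.basisVector 0)) +
        2 * M / p.2 ^ 2 * ((MvPoly.HomL2.eigenfun (K := K) two_le_three a) θ * fderiv ℝ Φ (spt p θ) (E4.basisVector 0)) +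
        (1 - 2 * M / p.2) * ((MvPoly.HomL2.eigenfun (K := K) two_le_three a) θ *
          fderiv ℝ (fderiv ℝ Φ) (spt p θ) (E4.spaceEmbed (θ : E3)) (E4.spaceEmbed (θ : E3))) +
        2 / p.2 * (1 - M / p.2) * ((MvPoly.HomL2.eigenfun (K := K) two_le_three a) θ * fderiv ℝ Φ (spt p θ) (E4.spaceEmbed (θ : E3))) +
        (p.2 ^ 2)⁻¹ * (-lam * ((MvPoly.HomL2.eigenfun (K := K) two_le_three a) θ * Φ (spt p θ)))) (volume : Measure E3).toSphere :=
      (((((iTT.const_mul _).add (iιT.const_mul _)).add (iT.const_mul _)).add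
        (iιι.const_mul _)).add (iι.const_mul _)).add ((i0.const_mul _).const_mul _)
    have hI' := (hI.const_mul (-(p.2 ^ 2))).sub (i0.const_mul lam)
    refine hI'.congr (Eventually.of_forall fun θ ↦ ?_)
    have h := hIeq θ
    simp only [Pi.sub_apply]
    rw [h]
    field_simp
    ring
  rw [integral_add hGS (i0.const_mul lam), integral_const_mul, hibp, hsame]
  ring

end Reduction

end EternalPapapetrou.ModeRigidity

end Summit.FinalStateConjecture.FinalStateConjecture.Theorems
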